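import Mathlib
import Summits.ResolutionOfSingularities.ResolutionOfSingularities.Theorems.HomologicalConductorNoZenoSplitModel
import Summits.ResolutionOfSingularities.ResolutionOfSingularities.Theorems.HomologicalConductorNoZenoSplittingBaseNormal
import Summits.ResolutionOfSingularities.ResolutionOfSingularities.Theorems.HomologicalConductorNoZenoThreadStep
import HarnessLib

/-!
# D2′ part 2b-ii: «`AdjoinRoot` commutes with localisation at `P`» for the split model

W4.4 (crux `NoZenoR`, stmt-ResolutionOfSingularities-19943), `stub_L1wCore` route (F1), upstairs
thread data. Setting of `exists_splitModel` (res-L0-w44-stub-2): `T : Subalgebra k K` with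
`Frac T = K`, `f ∈ T[X]` monic with `f_K` irreducible, `K_f = K[X]/(f_K)`, and the model
`T_f ⊆ K_f` with `e : T[X]/(f) ≃ T_f` (root ↦ root, `t ↦ t`). For a prime `P` of `T` let
`D := locPrime T P` (the germ, a subring of `K`) and `f_D ∈ D[X]` the image of `f`. We build the
natural map `Φ : D[X]/(f_D) → K_f` and prove: `Φ` is injective, and for every prime `𝔓` of `T_f`
lying over `P` its image lies in `locPrime T_f 𝔓`; when moreover `f` has irreducible reduction
modulo `𝔪_D` (the splitting-base situation), `locPrime T_f 𝔓` IS the image, so that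
**`locPrime T_f 𝔓 ≃+* D[X]/(f_D)`** — the upstairs germ is the splitting base of the downstairs germ,
and the BC-0/BC-0′/BC-N♯ bundles apply to it. Everything is PROVED.

OURS (cell res-hironaka, chain W4.4); AI-written, weaker than expert review; nothing here is a
statement of the manuscript under review.
-/

noncomputable section

set_option linter.dupNamespace false

open IsLocalRing Polynomial
open Summit.ResolutionOfSingularities.ResolutionOfSingularities.Theorems.NoZeno.SandwichCluster
open Summit.ResolutionOfSingularities.ResolutionOfSingularities.Theorems.NoZeno.SandwichCluster.Parasite
  (locPrime mem_locPrime_iff mem_locPrime_of_mem inv_mem_locPrime_of_not_mem)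

namespace Summit.ResolutionOfSingularities.ResolutionOfSingularities.Theorems.NoZeno.SplittingBase

variable {k K : Type} [Field k] [Field K] [Algebra k K]

/-- The germ `D = T_P` as a `k`-subalgebra of `K`. [this work] -/
def locPrimeSubalgebra (T : Subalgebra k K) (P : Ideal ↥T) (hP : P.IsPrime) : Subalgebra k K :=
  { locPrime T P hP with
    algebraMap_mem' := fun c => mem_locPrime_of_mem T P hP (T.algebraMap_mem c) }

/-- Underlying subring of `locPrimeSubalgebra`. [this work] -/
theorem locPrimeSubalgebra_toSubring (T : Subalgebra k K) (P : Ideal ↥T) (hP : P.IsPrime) :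
    (locPrimeSubalgebra T P hP).toSubring = locPrime T P hP := rfl

/-- Membership in `locPrimeSubalgebra` is membership in `locPrime`. [this work] -/
theorem mem_locPrimeSubalgebra_iff (T : Subalgebra k K) (P : Ideal ↥T) (hP : P.IsPrime) {x : K} :
    x ∈ locPrimeSubalgebra T P hP ↔ x ∈ locPrime T P hP := Iff.rfl

/-- `T ≤ T_P`. [this work] -/
theorem le_locPrimeSubalgebra (T : Subalgebra k K) (P : Ideal ↥T) (hP : P.IsPrime) :
    T ≤ locPrimeSubalgebra T P hP := fun _ hx => mem_locPrime_of_mem T P hP hx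

section Setup

variable (T : Subalgebra k K) (P : Ideal ↥T) (hP : P.IsPrime) (f : (↥T)[X])

/-- `f` read over the germ `D = T_P`. [this work] -/
def mapGerm : (↥(locPrimeSubalgebra T P hP))[X] :=
  f.map (Subalgebra.inclusion (le_locPrimeSubalgebra T P hP)).toRingHom

/-- `f_D` maps to `f_K` in `K[X]`. [this work] -/
theorem mapGerm_map :
    (mapGerm T P hP f).map (algebraMap ↥(locPrimeSubalgebra T P hP) K) = f.map (algebraMap ↥T K) := by
  rw [mapGerm, Polynomial.map_map]
  rfl

/-- `f_D` is monic when `f` is. [this work] -/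
theorem monic_mapGerm (hf : f.Monic) : (mapGerm T P hP f).Monic := hf.map _

/-- The root of `f_K` in `K_f` is a root of `f_D`. [this work] -/
theorem eval₂_mapGerm_root :
    (mapGerm T P hP f).eval₂ (algebraMap ↥(locPrimeSubalgebra T P hP) (AdjoinRoot (f.map (algebraMap ↥T K))))
      (AdjoinRoot.root (f.map (algebraMap ↥T K))) = 0 := by
  have h := eval₂_root_map_eq_zero (locPrimeSubalgebra T P hP) (mapGerm T P hP f)
  rw [mapGerm_map] at h
  exact h

/-- **The map `Φ : D[X]/(f_D) → K_f`** (`root ↦ root`, `D ⊆ K ⊆ K_f`). [this work] -/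
def germLift : AdjoinRoot (mapGerm T P hP f) →ₐ[↥(locPrimeSubalgebra T P hP)]
    AdjoinRoot (f.map (algebraMap ↥T K)) :=
  AdjoinRoot.liftAlgHom (mapGerm T P hP f) (Algebra.ofId _ _) (AdjoinRoot.root _)
    (eval₂_mapGerm_root T P hP f)

/-- `Φ` on classes of polynomials. [this work] -/
theorem germLift_mk (g : (↥(locPrimeSubalgebra T P hP))[X]) :
    germLift T P hP f (AdjoinRoot.mk _ g) =
      aeval (AdjoinRoot.root (f.map (algebraMap ↥T K)))
        (g.map (algebraMap ↥(locPrimeSubalgebra T P hP) K)) := by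
  rw [germLift, AdjoinRoot.liftAlgHom_mk, aeval_map_algebraMap, aeval_def]
  rfl

/-- **`Φ` is injective** (`f_D` monic, `D ⊆ K`). [this work] -/
theorem germLift_injective (hf : f.Monic) : Function.Injective (germLift T P hP f) := by
  rw [injective_iff_map_eq_zero]
  intro x hx
  induction x using AdjoinRoot.induction_on with
  | ih g =>
    rw [germLift_mk, AdjoinRoot.aeval_eq, AdjoinRoot.mk_eq_zero, ← mapGerm_map,
      Polynomial.map_dvd_map _ (FaithfulSMul.algebraMap_injective _ _) (monic_mapGerm T P hP f hf)]
      at hx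
    exact AdjoinRoot.mk_eq_zero.mpr hx

end Setup

section Image

variable (T : Subalgebra k K) (P : Ideal ↥T) (hP : P.IsPrime) (f : (↥T)[X])
  [Fact (Irreducible (f.map (algebraMap ↥T K)))]
  (Tf : Subalgebra k (AdjoinRoot (f.map (algebraMap ↥T K))))
  (e : AdjoinRoot f ≃ₐ[k] ↥Tf)
  (he_root : ((e (AdjoinRoot.root f) : ↥Tf) : AdjoinRoot (f.map (algebraMap ↥T K))) =
    AdjoinRoot.root (f.map (algebraMap ↥T K)))
  (he_of : ∀ t : ↥T, ((e (AdjoinRoot.of f t) : ↥Tf) : AdjoinRoot (f.map (algebraMap ↥T K))) =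
    algebraMap K _ (t : K))
  (𝔓 : Ideal ↥Tf) (h𝔓 : 𝔓.IsPrime) (hover : ∀ t : ↥T, e (AdjoinRoot.of f t) ∈ 𝔓 ↔ t ∈ P)

include he_of hover in
/-- Elements of the germ `D = T_P ⊆ K` land in `locPrime T_f 𝔓` for every prime `𝔓` of the model
over `P`. [this work] -/
theorem algebraMap_germ_mem_locPrime {d : K} (hd : d ∈ locPrime T P hP) :
    algebraMap K (AdjoinRoot (f.map (algebraMap ↥T K))) d ∈ locPrime Tf 𝔓 h𝔓 := by
  obtain ⟨a, b, ha, hb, hbP, rfl⟩ := hd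
  rw [map_mul, map_inv₀]
  have haT : algebraMap K (AdjoinRoot (f.map (algebraMap ↥T K))) a ∈ Tf := by
    rw [← he_of ⟨a, ha⟩]; exact (e _).2
  have hbT : algebraMap K (AdjoinRoot (f.map (algebraMap ↥T K))) b ∈ Tf := by
    rw [← he_of ⟨b, hb⟩]; exact (e _).2
  have hb𝔓 : (⟨_, hbT⟩ : ↥Tf) ∉ 𝔓 := by
    have : (⟨_, hbT⟩ : ↥Tf) = e (AdjoinRoot.of f ⟨b, hb⟩) := Subtype.ext (he_of ⟨b, hb⟩).symm
    rw [this, hover]; exact hbP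
  exact (locPrime Tf 𝔓 h𝔓).mul_mem (mem_locPrime_of_mem Tf 𝔓 h𝔓 haT)
    (inv_mem_locPrime_of_not_mem Tf 𝔓 h𝔓 hbT hb𝔓)

include he_root he_of hover in
/-- **The image of `Φ : D[X]/(f_D) → K_f` lies in `locPrime T_f 𝔓`** for every prime `𝔓` of the
model over `P`. [this work] -/
theorem germLift_mem_locPrime (x : AdjoinRoot (mapGerm T P hP f)) :
    germLift T P hP f x ∈ locPrime Tf 𝔓 h𝔓 := by
  -- `locPrime T_f 𝔓` as a `D`-subalgebra of `K_f`
  let L : Subalgebra ↥(locPrimeSubalgebra T P hP) (AdjoinRoot (f.map (algebraMap ↥T K))) :=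
    { locPrime Tf 𝔓 h𝔓 with
      algebraMap_mem' := fun d => by
        show algebraMap K _ (d : K) ∈ locPrime Tf 𝔓 h𝔓
        exact algebraMap_germ_mem_locPrime T P hP f Tf e he_of 𝔓 h𝔓 hover d.2 }
  have hroot : AdjoinRoot.root (f.map (algebraMap ↥T K)) ∈ L := by
    show AdjoinRoot.root (f.map (algebraMap ↥T K)) ∈ locPrime Tf 𝔓 h𝔓
    rw [← he_root]
    exact mem_locPrime_of_mem Tf 𝔓 h𝔓 (e _).2
  have hrange : (germLift T P hP f).range ≤ L := by
    rw [← Algebra.map_top, ← AdjoinRoot.adjoinRoot_eq_top, AlgHom.map_adjoin,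
      Set.image_singleton, Algebra.adjoin_le_iff, Set.singleton_subset_iff]
    show germLift T P hP f (AdjoinRoot.root _) ∈ L
    rw [germLift, AdjoinRoot.liftAlgHom_root]
    exact hroot
  exact hrange ⟨x, rfl⟩

end Image

/-- The germ is a local ring (`Parasite.isLocalRing_locPrime`, same carrier). [this work] -/
instance isLocalRing_locPrimeSubalgebra (T : Subalgebra k K) (P : Ideal ↥T) [hP : P.IsPrime] :
    IsLocalRing ↥(locPrimeSubalgebra T P hP) :=
  Parasite.isLocalRing_locPrime T P hP

section Iso

variable (T : Subalgebra k K) (P : Ideal ↥T) (hP : P.IsPrime) (f : (↥T)[X]) (hf : f.Monic)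
  [Fact (Irreducible (f.map (algebraMap ↥T K)))]
  (Tf : Subalgebra k (AdjoinRoot (f.map (algebraMap ↥T K))))
  (e : AdjoinRoot f ≃ₐ[k] ↥Tf)
  (he_root : ((e (AdjoinRoot.root f) : ↥Tf) : AdjoinRoot (f.map (algebraMap ↥T K))) =
    AdjoinRoot.root (f.map (algebraMap ↥T K)))
  (he_of : ∀ t : ↥T, ((e (AdjoinRoot.of f t) : ↥Tf) : AdjoinRoot (f.map (algebraMap ↥T K))) =
    algebraMap K _ (t : K))
  (𝔓 : Ideal ↥Tf) (h𝔓 : 𝔓.IsPrime) (hover : ∀ t : ↥T, e (AdjoinRoot.of f t) ∈ 𝔓 ↔ t ∈ P)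

/-- The comparison map `θ : T[X]/(f) → D[X]/(f_D)`. [this work] -/
def toGerm : AdjoinRoot f →+* AdjoinRoot (mapGerm T P hP f) :=
  AdjoinRoot.lift ((AdjoinRoot.of (mapGerm T P hP f)).comp
      (Subalgebra.inclusion (le_locPrimeSubalgebra T P hP)).toRingHom)
    (AdjoinRoot.root (mapGerm T P hP f))
    (by rw [← Polynomial.eval₂_map]; exact AdjoinRoot.eval₂_root _)

include he_root he_of in
/-- `Φ ∘ θ = e` (as maps into `K_f`). [this work] -/
theorem germLift_toGerm (x : AdjoinRoot f) :
    germLift T P hP f (toGerm T P hP f x) = (e x : AdjoinRoot (f.map (algebraMap ↥T K))) := by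
  have key : (germLift T P hP f).toRingHom.comp (toGerm T P hP f) =
      (Tf.val.toRingHom).comp (e.toAlgHom.toRingHom) := by
    apply Ideal.Quotient.ringHom_ext
    apply Polynomial.ringHom_ext
    · intro t
      change germLift T P hP f (toGerm T P hP f (AdjoinRoot.of f t)) = (e (AdjoinRoot.of f t) : _)
      rw [he_of, toGerm, AdjoinRoot.lift_of, RingHom.comp_apply, germLift, AdjoinRoot.liftAlgHom_of]
      rfl
    · change germLift T P hP f (toGerm T P hP f (AdjoinRoot.root f)) = (e (AdjoinRoot.root f) : _)
      rw [he_root, toGerm, AdjoinRoot.lift_root, germLift, AdjoinRoot.liftAlgHom_root]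
  exact congrArg (fun φ : AdjoinRoot f →+* _ => φ x) key

/-- Elements of `T_f` outside `𝔓` are units of the local ring `locPrime T_f 𝔓`; elements of `𝔓`
are non-units there. [this work] -/
theorem isUnit_locPrime_iff_of_mem {u : AdjoinRoot (f.map (algebraMap ↥T K))} (hu : u ∈ Tf)
    (huL : u ∈ locPrime Tf 𝔓 h𝔓) :
    IsUnit (⟨u, huL⟩ : ↥(locPrime Tf 𝔓 h𝔓)) ↔ (⟨u, hu⟩ : ↥Tf) ∉ 𝔓 := by
  constructor
  · intro hunit hmem
    by_cases hu0 : u = 0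
    · apply h𝔓.ne_top
      rw [Ideal.eq_top_iff_one]
      have h1 : (⟨u, huL⟩ : ↥(locPrime Tf 𝔓 h𝔓)) = 0 := Subtype.ext hu0
      rw [h1, isUnit_zero_iff] at hunit
      have : (1 : ↥Tf) = 0 := Subtype.ext (by
        have := congrArg (fun z : ↥(locPrime Tf 𝔓 h𝔓) => (z : AdjoinRoot (f.map (algebraMap ↥T K)))) hunit
        simp at this)
      rw [this]; exact 𝔓.zero_mem
    · obtain ⟨v, hv⟩ := hunit.exists_right_inv
      have hvinv : (v : AdjoinRoot (f.map (algebraMap ↥T K))) = u⁻¹ := by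
        have := congrArg (fun z : ↥(locPrime Tf 𝔓 h𝔓) => (z : AdjoinRoot (f.map (algebraMap ↥T K)))) hv
        simp only [Subring.coe_mul, Subring.coe_one] at this
        exact (eq_inv_of_mul_eq_one_right this)
      exact Parasite.inv_not_mem_locPrime_of_mem Tf 𝔓 h𝔓 hu hmem hu0 (hvinv ▸ v.2)
  · intro hnot
    have hinv : u⁻¹ ∈ locPrime Tf 𝔓 h𝔓 := inv_mem_locPrime_of_not_mem Tf 𝔓 h𝔓 hu hnot
    have hu0 : u ≠ 0 := fun h => hnot (by
      have : (⟨u, hu⟩ : ↥Tf) = 0 := Subtype.ext h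
      rw [this]; exact 𝔓.zero_mem)
    exact ⟨⟨⟨u, huL⟩, ⟨u⁻¹, hinv⟩, Subtype.ext (mul_inv_cancel₀ hu0),
      Subtype.ext (inv_mul_cancel₀ hu0)⟩, rfl⟩

include hf hover he_of he_root in
/-- **Units are detected upstairs**: if `f` has irreducible reduction modulo `𝔪_D` (so that
`B_D = D[X]/(f_D)` is local with maximal ideal `𝔪_D·B_D`), an element of `B_D` whose image in
`locPrime T_f 𝔓` is a unit is a unit. [this work] -/
theorem isUnit_of_isUnit_germLift
    (hirr : Irreducible ((mapGerm T P hP f).map (residue ↥(locPrimeSubalgebra T P hP))))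
    (w : AdjoinRoot (mapGerm T P hP f))
    (hw : IsUnit (⟨germLift T P hP f w, germLift_mem_locPrime T P hP f Tf e he_root he_of 𝔓 h𝔓
      hover w⟩ : ↥(locPrime Tf 𝔓 h𝔓))) : IsUnit w := by
  haveI hL : IsLocalRing ↥(locPrime Tf 𝔓 h𝔓) := Parasite.isLocalRing_locPrime Tf 𝔓 h𝔓
  obtain ⟨hloc, -, hmB⟩ := adjoinRoot_isLocalRing_of_irreducible (monic_mapGerm T P hP f hf) hirr
  -- `Φ` with values in the local ring `L = locPrime T_f 𝔓`
  let ΦL : AdjoinRoot (mapGerm T P hP f) →+* ↥(locPrime Tf 𝔓 h𝔓) :=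
    (germLift T P hP f).toRingHom.codRestrict _
      (germLift_mem_locPrime T P hP f Tf e he_root he_of 𝔓 h𝔓 hover)
  -- the pull-back of `𝔪_L` contains `𝔪_D · B_D`
  let 𝔮 : Ideal (AdjoinRoot (mapGerm T P hP f)) := (maximalIdeal _).comap ΦL
  have h𝔮 : (maximalIdeal ↥(locPrimeSubalgebra T P hP)).map
      (algebraMap _ (AdjoinRoot (mapGerm T P hP f))) ≤ 𝔮 := by
    rw [Ideal.map_le_iff_le_comap]
    intro d hd
    -- `d = a b⁻¹` with `a ∈ P` (else `d` is a unit of `D`)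
    obtain ⟨a, b, ha, hb, hbP, hdab⟩ := (mem_locPrime_iff T P hP).mp d.2
    have haP : (⟨a, ha⟩ : ↥T) ∈ P := by
      by_contra haP
      apply (IsLocalRing.mem_maximalIdeal _).mp hd
      have hinv : b * a⁻¹ ∈ locPrime T P hP := ⟨b, a, hb, ha, haP, rfl⟩
      have ha0 : a ≠ 0 := Parasite.ne_zero_of_not_mem_ideal T P ha haP
      have hb0 : b ≠ 0 := Parasite.ne_zero_of_not_mem_ideal T P hb hbP
      refine ⟨⟨d, ⟨b * a⁻¹, hinv⟩, Subtype.ext ?_, Subtype.ext ?_⟩, rfl⟩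
      · show (d : K) * (b * a⁻¹) = 1
        rw [hdab]; field_simp
      · show b * a⁻¹ * (d : K) = 1
        rw [hdab]; field_simp
    -- its image `α β⁻¹` in `L`, `α ∈ 𝔓`, `β ∈ T_f ∖ 𝔓`, is a non-unit
    show ΦL (algebraMap _ _ d) ∈ maximalIdeal _
    rw [IsLocalRing.mem_maximalIdeal, mem_nonunits_iff]
    have hval : (ΦL (algebraMap _ _ d) : AdjoinRoot (f.map (algebraMap ↥T K))) =
        algebraMap K _ a * (algebraMap K _ b)⁻¹ := by
      show germLift T P hP f (algebraMap _ _ d) = _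
      rw [AlgHom.commutes]
      show algebraMap K _ (d : K) = _
      rw [hdab, map_mul, map_inv₀]
    have haT : algebraMap K (AdjoinRoot (f.map (algebraMap ↥T K))) a ∈ Tf := by
      rw [← he_of ⟨a, ha⟩]; exact (e _).2
    have hbT : algebraMap K (AdjoinRoot (f.map (algebraMap ↥T K))) b ∈ Tf := by
      rw [← he_of ⟨b, hb⟩]; exact (e _).2
    have ha𝔓 : (⟨_, haT⟩ : ↥Tf) ∈ 𝔓 := by
      have : (⟨_, haT⟩ : ↥Tf) = e (AdjoinRoot.of f ⟨a, ha⟩) := Subtype.ext (he_of ⟨a, ha⟩).symm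
      rw [this, hover]; exact haP
    have hb𝔓 : (⟨_, hbT⟩ : ↥Tf) ∉ 𝔓 := by
      have : (⟨_, hbT⟩ : ↥Tf) = e (AdjoinRoot.of f ⟨b, hb⟩) := Subtype.ext (he_of ⟨b, hb⟩).symm
      rw [this, hover]; exact hbP
    have haL := mem_locPrime_of_mem Tf 𝔓 h𝔓 haT
    have hbL := mem_locPrime_of_mem Tf 𝔓 h𝔓 hbT
    have hbunit : IsUnit (⟨_, hbL⟩ : ↥(locPrime Tf 𝔓 h𝔓)) :=
      (isUnit_locPrime_iff_of_mem (T := T) (f := f) (Tf := Tf) (𝔓 := 𝔓) (h𝔓 := h𝔓) hbT hbL).mpr hb𝔓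
    have hanot : ¬ IsUnit (⟨_, haL⟩ : ↥(locPrime Tf 𝔓 h𝔓)) := fun h =>
      (isUnit_locPrime_iff_of_mem (T := T) (f := f) (Tf := Tf) (𝔓 := 𝔓) (h𝔓 := h𝔓) haT haL).mp h ha𝔓
    intro hunit
    apply hanot
    -- `α = (α β⁻¹) · β`
    have hprod : (⟨_, haL⟩ : ↥(locPrime Tf 𝔓 h𝔓)) = ΦL (algebraMap _ _ d) * ⟨_, hbL⟩ := by
      apply Subtype.ext
      show algebraMap K _ a = (ΦL (algebraMap _ _ d) : AdjoinRoot (f.map (algebraMap ↥T K))) *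
        algebraMap K _ b
      rw [hval, inv_mul_cancel_right₀]
      rw [_root_.map_ne_zero]
      exact Parasite.ne_zero_of_not_mem_ideal T P hb hbP
    rw [hprod]
    exact hunit.mul hbunit
  -- hence `𝔮 = 𝔪_{B_D}` and non-units map to non-units
  have h𝔮top : 𝔮 ≠ ⊤ := by
    intro h
    have : (1 : AdjoinRoot (mapGerm T P hP f)) ∈ 𝔮 := h ▸ Submodule.mem_top
    have h1 : ΦL 1 ∈ maximalIdeal _ := this
    rw [map_one] at h1
    exact (IsLocalRing.mem_maximalIdeal _).mp h1 isUnit_one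
  have h𝔮eq : 𝔮 = maximalIdeal _ := by
    refine ((IsLocalRing.maximalIdeal.isMaximal _).eq_of_le h𝔮top ?_).symm
    rw [← hmB]; exact h𝔮
  by_contra hnu
  have hmem : w ∈ maximalIdeal _ := (IsLocalRing.mem_maximalIdeal _).mpr hnu
  rw [← h𝔮eq] at hmem
  exact (IsLocalRing.mem_maximalIdeal _).mp hmem hw

include hf hover he_of he_root in
/-- **The upstairs germ is the image of `Φ`**: under irreducible reduction of `f` modulo `𝔪_D`,
every element of `locPrime T_f 𝔓` is `Φ` of an element of `D[X]/(f_D)`. [this work] -/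
theorem exists_germLift_eq_of_mem_locPrime
    (hirr : Irreducible ((mapGerm T P hP f).map (residue ↥(locPrimeSubalgebra T P hP))))
    {y : AdjoinRoot (f.map (algebraMap ↥T K))} (hy : y ∈ locPrime Tf 𝔓 h𝔓) :
    ∃ w, germLift T P hP f w = y := by
  obtain ⟨a', b', ha', hb', hb'𝔓, rfl⟩ := hy
  set x := e.symm ⟨a', ha'⟩ with hxdef
  set z := e.symm ⟨b', hb'⟩ with hzdef
  have hx : ((e x : ↥Tf) : AdjoinRoot (f.map (algebraMap ↥T K))) = a' := by
    rw [hxdef, AlgEquiv.apply_symm_apply]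
  have hz : ((e z : ↥Tf) : AdjoinRoot (f.map (algebraMap ↥T K))) = b' := by
    rw [hzdef, AlgEquiv.apply_symm_apply]
  have hval : germLift T P hP f (toGerm T P hP f z) = b' := by
    rw [germLift_toGerm T P hP f Tf e he_root he_of, hz]
  have hmem : b' ∈ locPrime Tf 𝔓 h𝔓 := mem_locPrime_of_mem Tf 𝔓 h𝔓 hb'
  have hzu : IsUnit (toGerm T P hP f z) := by
    apply isUnit_of_isUnit_germLift T P hP f hf Tf e he_root he_of 𝔓 h𝔓 hover hirr
    have key : (⟨germLift T P hP f (toGerm T P hP f z), germLift_mem_locPrime T P hP f Tf e he_root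
        he_of 𝔓 h𝔓 hover (toGerm T P hP f z)⟩ : ↥(locPrime Tf 𝔓 h𝔓)) = ⟨b', hmem⟩ :=
      Subtype.ext hval
    rw [key]
    exact (isUnit_locPrime_iff_of_mem (T := T) (f := f) (Tf := Tf) (𝔓 := 𝔓) (h𝔓 := h𝔓)
      hb' hmem).mpr hb'𝔓
  obtain ⟨u, hu⟩ := hzu
  refine ⟨toGerm T P hP f x * ↑u⁻¹, ?_⟩
  have h1 : germLift T P hP f ↑u * germLift T P hP f ↑u⁻¹ = 1 := by
    rw [← map_mul, Units.mul_inv, map_one]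
  have h2 : germLift T P hP f ↑u = b' := by rw [hu, hval]
  rw [h2] at h1
  rw [map_mul, germLift_toGerm T P hP f Tf e he_root he_of, hx, eq_inv_of_mul_eq_one_right h1]

include hf hover he_of he_root in
/-- **«`AdjoinRoot` commutes with localisation at `P`» (irreducible reduction).** For the split
model `T_f` of `exists_splitModel` and any prime `𝔓` of `T_f` over `P`: if `f` has irreducible
reduction modulo `𝔪_D`, `D = T_P`, then the upstairs germ `locPrime T_f 𝔓` is ring-isomorphic to
`D[X]/(f_D)` — the splitting base of the downstairs germ — compatibly with `Φ`. Hence the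
BC-0 / BC-N♯ / local-étale bundles (`…SplittingBase{,Normal}`) transfer to the upstairs germ.
[this work] -/
theorem exists_ringEquiv_locPrime_adjoinRoot
    (hirr : Irreducible ((mapGerm T P hP f).map (residue ↥(locPrimeSubalgebra T P hP)))) :
    ∃ E : AdjoinRoot (mapGerm T P hP f) ≃+* ↥(locPrime Tf 𝔓 h𝔓),
      ∀ w, (E w : AdjoinRoot (f.map (algebraMap ↥T K))) = germLift T P hP f w := by
  let ΦL : AdjoinRoot (mapGerm T P hP f) →+* ↥(locPrime Tf 𝔓 h𝔓) :=
    (germLift T P hP f).toRingHom.codRestrict _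
      (germLift_mem_locPrime T P hP f Tf e he_root he_of 𝔓 h𝔓 hover)
  have hinj : Function.Injective ΦL := fun a b h => germLift_injective T P hP f hf (by
    have := congrArg (fun z : ↥(locPrime Tf 𝔓 h𝔓) => (z : AdjoinRoot (f.map (algebraMap ↥T K)))) h
    exact this)
  have hsurj : Function.Surjective ΦL := fun y => by
    obtain ⟨w, hw⟩ := exists_germLift_eq_of_mem_locPrime T P hP f hf Tf e he_root he_of 𝔓 h𝔓 hover
      hirr y.2
    exact ⟨w, Subtype.ext hw⟩
  exact ⟨RingEquiv.ofBijective ΦL ⟨hinj, hsurj⟩, fun _ => rfl⟩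

end Iso

end Summit.ResolutionOfSingularities.ResolutionOfSingularities.Theorems.NoZeno.SplittingBase

end
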